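import Summits.BirchSwinnertonDyer.BirchSwinnertonDyer.Theorems.ByReductionTypeAtTwoMultIsogenyDictionary
import HarnessLib

/-!
# The `μ`-SHIFT LAW at analytic rank `0` on the MULTIPLICATIVE-at-`2` block (route ByReductionTypeAtTwo,
# crux `MultLowerHalfAtTwo` = item stmt-BirchSwinnertonDyer-19923; seat bsd-2adic-mult-3, GEN 5 — file 2 of 3)

HONEST FRAMING (cell `bsd-2adic`, HUMAN RULINGS D-0036/D-0074): THEOREMS ONLY — no definition, no named
fact, nothing asserted, closes nothing; BSD is not proved by any of this. PUBLISHED inputs are displayed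
hypotheses exactly as in the seat's GEN 0–5 files: Greenberg's "analogue of Thm. 4.1" at a NON-SPLIT
multiplicative `2` at both members (`hEC`, `hEC'`: `X5.O1.TwoAdicEulerCharRankZeroNonsplitMult · 0`, i.e.
the GUARDED twin A235′ read at `2`, p428013) resp. at a SPLIT `2` (`X5.O1.TwoAdicEulerCharRankZeroSplitMult · 0`,
A236), Gross–Zagier–Kolyvagin (`hGZK`), Cassels' isogeny invariance of the BSD quotient (`hCassels`);
at a split `2` the MEMO input Greenberg–Stevens at `2` at both members (`hGS`, `hGS'`). No Schneider /
Perrin-Riou isogeny theorem is used or asserted.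

WHAT. The ord lane (bsd-2adic-ord GEN 7 / ord-3 GEN 3, `…OrdKatoHalfIsogenyMu`, `…OrdIsogenyDualMaps`,
`…OrdIsogenyMuShift`) proved, for every prime and every isogeny, the ALGEBRAIC shift
`μ(X(E)) + ord f_{X(E')}(0) = μ(X(E')) + ord f_{X(E)}(0)` and pinned the right-hand side on the rank-`0`
GOOD-ORDINARY-at-`2` locus by Greenberg's Thm. 4.1 + Cassels. This file does the same on the rank-`0`
MULTIPLICATIVE-at-`2` locus, both signs:

* (file 1, `…MultIsogenyDictionary.lean`) rank-`0` dictionaries at a multiplicative `2`: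
  non-split `ord₂ f_X(0) = (ord₂ #Ш − ord₂ #Ш_an) + ord₂ ϖ + ord₂ [0]⁺_f + 1`, split
  `ord₂ f_X(0) = (ord₂ #Ш − ord₂ #Ш_an) + ord₂ ϖ + ord₂ [T¹]L₂(f,1)`; everything except `ord₂ #Ш − ord₂ #Ш_an`
  and `ord₂ ϖ` depends on the newform `f` only.
* §2 (this file) **THE `μ`-SHIFT LAW AT RANK `0`, multiplicative `2`** (`mu_add_padicValRat_eq_of_isIsogenous_nonsplit`,
  `…_split`): for ℚ-isogenous globally minimal `W ∼ W'` multiplicative at `2` of analytic rank `0` with common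
  newform `f` and `ϖ·Ω_W = Ω⁺_f = ϖ'·Ω_{W'}`: **`μ(X(W)) + ord₂ ϖ' = μ(X(W')) + ord₂ ϖ`** — Greenberg's
  "`μ_E − μ_{E'} = ord₂(Ω_{E'}/Ω_E)`" (LNM 1716 p. 121, printed for odd `p`) at `p = 2` on this locus, from
  §1 at both members, the algebraic shift, and `#Ш_an(W)/#Ш_an(W') = #Ш(W)/#Ш(W')` (Cassels + `L`-invariance).

Sequel (`…MultIsogenyEisensteinTransport.lean`): with the law, the seat's typed research object
`X5.O1.MultEisensteinDivisibilityAtTwo` (T-mult-4-int) transports member to member at analytic rank `0`, so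
the isogeny-hedged WALL stubs of LINE `two_halves` are EQUIVALENT to the member-wise ones there.
PARTITION (D-0054): X5@2 mult (K4ᵐ, RESIDUAL-MAP B1·O1; 1 976 book230 classes) × p = 2 — types-the-object-of
(item 19923: the μ-isogeny law on its domain); closes none; nothing booked.

References: R. Greenberg, LNM 1716 (1999), §4 pp. 112–113 (analogues of Thm. 4.1 at a multiplicative prime),
§5 p. 121 (isogenies and `μ`); B. Mazur, J. Tate, J. Teitelbaum, Invent. Math. 84 (1986) §I.14–15;
R. Greenberg, G. Stevens, Invent. Math. 111 (1993); J. W. S. Cassels, J. reine angew. Math. 217 (1965);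
R. L. Miller, LMS J. Comput. Math. 14 (2011) Def. 1.1.
-/

set_option autoImplicit false
set_option linter.dupNamespace false

noncomputable section

open scoped Classical MatrixGroups ModularForm

open CongruenceSubgroup WeierstrassCurve Literature.NumberTheory.EllipticCurves
  Literature.NumberTheory.EllipticCurves.ModularForms Literature.NumberTheory.EllipticCurves.Greenberg1999
  Literature.NumberTheory.EllipticCurves.Wuthrich2014 Literature.NumberTheory.Transcendental
  Literature.NumberTheory.EllipticCurves.Rank1Residual Literature.NumberTheory.EllipticCurves.Rank1Residual.Typed
  Summit.BirchSwinnertonDyer.Rank1Residual Summit.BirchSwinnertonDyer.Rank1Residual.X5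
  Summit.BirchSwinnertonDyer.BirchSwinnertonDyer.Theorems.EisensteinShaCurrency
  Summit.BirchSwinnertonDyer.BirchSwinnertonDyer.Theorems.IsogenyMuShift

universe u

namespace Summit.BirchSwinnertonDyer.BirchSwinnertonDyer.Theorems.MultIsogenyShift

/-! ## §2 THE `μ`-SHIFT LAW at analytic rank `0`, multiplicative `2` -/

section MuShift

variable {W W' : WeierstrassCurve ℚ} [W.IsElliptic] [W'.IsElliptic] [W.IsGloballyMinimal]
  [W'.IsGloballyMinimal]

/-- **THE `μ`-SHIFT LAW AT ANALYTIC RANK `0`, NON-SPLIT multiplicative `2` (PROVED from the guarded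
Thm-4.1 analogue + Cassels; no Schneider–Perrin-Riou).** `W ∼ W'` ℚ-isogenous globally minimal curves,
`W` non-split multiplicative at `2` with `L(E,1) ≠ 0`; PUB: the non-split display at both members
(`hEC`, `hEC'`), GZK, Cassels; a cyclotomic datum, the common newform `f` (any level), dual data `D`,
`D'` with `X(W)` torsion, and `ϖ·Ω_W = Ω⁺_f = ϖ'·Ω_{W'}`. Then **`μ(X(W)) + ord₂ ϖ' = μ(X(W')) + ord₂ ϖ`**
— Greenberg's "`μ_E` changes as the period" at `p = 2` on this locus. Proof: the algebraic shift
`μ − μ' = ord₂ f_X(0) − ord₂ f_{X'}(0)` (`…OrdIsogenyDualMaps`), §1 at both members (the `f`-only terms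
cancel), and `#Ш_an(W)/#Ш_an(W') = #Ш(W)/#Ш(W')` (Cassels + `L(W,1) = L(W',1)`).
[cite: GreenbergLNM1716, §4 pp. 112–113 and §5 p. 121] [cite: MilneADT2006, Thm. I.7.3 (Cassels)]
[cite: Knapp1993, Thm. 11.67] -/
theorem mu_add_padicValRat_eq_of_isIsogenous_nonsplit (hCassels : bsdRHS_eq_of_isIsogenous)
    (hGZK : rank_eq_analyticRank_of_analyticRank_le_one) (hiso : IsIsogenous W W')
    (hEC : O1.TwoAdicEulerCharRankZeroNonsplitMult W 0)
    (hEC' : O1.TwoAdicEulerCharRankZeroNonsplitMult W' 0)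
    (hmult : Mult W 2) (hns : ¬ W.HasSplitMultiplicativeReductionAtPrime 2)
    (hL : W.entireLFunction 1 ≠ 0)
    {κ : ZpExtension ℚ 2} {γ : Field.absoluteGaloisGroup ℚ} {N : ℕ} [NeZero N]
    {f : CuspForm (Gamma0 N) 2} (hκ : κ.IsCyclotomic) (hγ : κ.IsTopGenerator γ)
    (hγ' : IsCyclotomicVariable 2 γ) (hf : IsNewformOf W f) (D : W.SelmerDualData κ γ)
    (D' : W'.SelmerDualData κ γ) (hX : D.IsTorsion) {ϖ ϖ' : ℚ}
    (hϖ : (ϖ : ℝ) * W.realPeriodRat = plusPeriod f) (hϖ' : (ϖ' : ℝ) * W'.realPeriodRat = plusPeriod f) :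
    (D.mu : ℤ) + padicValRat 2 ϖ' = (D'.mu : ℤ) + padicValRat 2 ϖ := by
  haveI : Module.Finite (IwasawaAlgebra 2) D.X := D.module_finite_holds hγ
  haveI : Module.Finite (IwasawaAlgebra 2) D'.X := D'.module_finite_holds hγ
  have hX' : D'.IsTorsion := isTorsion_of_isIsogenous hiso D D' hX
  have hmult' : Mult W' 2 := mult_two_of_isIsogenous hiso hmult
  have hns' : ¬ W'.HasSplitMultiplicativeReductionAtPrime 2 :=
    fun h => hns ((hasSplitMultiplicativeReductionAtPrime_two_iff_of_isIsogenous hiso).mpr h)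
  have hL' : W'.entireLFunction 1 ≠ 0 := entireLFunction_one_ne_zero_of_isIsogenous hiso hL
  have hf' : IsNewformOf W' f := hf.of_isIsogenous hiso.symm_of_charZero
  -- generators
  obtain ⟨fX, hfX⟩ := (charIdeal_isPrincipal_holds 2 D.X).principal
  have hchar : D.charIdeal = Ideal.span {fX} := hfX
  obtain ⟨fX', hfX'⟩ := (charIdeal_isPrincipal_holds 2 D'.X).principal
  have hchar' : D'.charIdeal = Ideal.span {fX'} := hfX'
  -- the dictionaries at both members
  obtain ⟨q, hq, hq0, hfX0, hdict⟩ := exists_shaAn_eq_and_valuation_constantCoeff_charGen_eq_nonsplit W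
    hEC hGZK hmult hns hL hκ hγ hγ' hf D hX hϖ hchar
  obtain ⟨q', hq', hq0', -, hdict'⟩ := exists_shaAn_eq_and_valuation_constantCoeff_charGen_eq_nonsplit W'
    hEC' hGZK hmult' hns' hL' hκ hγ hγ' hf' D' hX' hϖ' hchar'
  -- the algebraic shift
  obtain ⟨-, -, hshift⟩ :=
    mu_add_valuation_constantCoeff_eq_of_isIsogenous hiso D D' hX hchar hchar' hfX0
  -- Cassels: `#Ш_an(W) = #Ш_an(W')·#Ш(W)/#Ш(W')`
  have hr' : W'.analyticRank = 0 := analyticRank_eq_zero_of_entireLFunction_one_ne_zero W' hL'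
  have hfin' : Finite W'.sha := (hGZK W' (by rw [hr']; exact zero_le_one)).2
  have hlead : W'.leadingLCoeff ≠ 0 := W'.leadingLCoeff_ne_zero_holds hf'.hasEntireLFunction
  obtain ⟨hfin, hkey⟩ := finite_sha_and_shaAn_eq_of_isIsogenous hCassels hiso hfin' hlead
  haveI : Finite W.sha := hfin
  haveI : Finite W'.sha := hfin'
  have hshaQ : (W.shaOrder : ℚ) ≠ 0 := by exact_mod_cast (W.shaOrder_pos hfin).ne'
  have hshaQ' : (W'.shaOrder : ℚ) ≠ 0 := by exact_mod_cast (W'.shaOrder_pos hfin').ne'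
  have hqq : q = q' * (W.shaOrder : ℚ) / (W'.shaOrder : ℚ) := by
    have h1 : ((q : ℚ) : ℂ) = ((q' * (W.shaOrder : ℚ) / (W'.shaOrder : ℚ) : ℚ) : ℂ) := by
      rw [← hq, hkey, hq']; push_cast; rfl
    exact_mod_cast h1
  have hvq : padicValRat 2 q = padicValRat 2 q' + (padicValNat 2 W.shaOrder : ℤ) -
      (padicValNat 2 W'.shaOrder : ℤ) := by
    rw [hqq, padicValRat.div (mul_ne_zero hq0' hshaQ) hshaQ', padicValRat.mul hq0' hshaQ,
      padicValRat.of_nat, padicValRat.of_nat]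
  -- assemble
  linarith [hdict, hdict', hshift, hvq]

/-- **THE `μ`-SHIFT LAW AT ANALYTIC RANK `0`, SPLIT multiplicative `2`.** As the non-split law, with the
split display A236 at both members (`hEC`, `hEC'`) and the MEMO input Greenberg–Stevens at `2` at both
(`hGS`, `hGS'`; used to trade `𝓛₂·[0]⁺_f` for the class datum `[T¹]L₂(f,1)` in §1, so the two
`𝓛`-invariants never need to be compared directly). **`μ(X(W)) + ord₂ ϖ' = μ(X(W')) + ord₂ ϖ`.**
[cite: GreenbergLNM1716, §4 pp. 112–113 and §5 p. 121] [cite: GreenbergStevens1993, Theorem of the Introduction (shape)]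
[cite: MilneADT2006, Thm. I.7.3 (Cassels)] -/
theorem mu_add_padicValRat_eq_of_isIsogenous_split (hCassels : bsdRHS_eq_of_isIsogenous)
    (hGZK : rank_eq_analyticRank_of_analyticRank_le_one) (hiso : IsIsogenous W W')
    (hEC : O1.TwoAdicEulerCharRankZeroSplitMult W 0)
    (hEC' : O1.TwoAdicEulerCharRankZeroSplitMult W' 0)
    (hGS : greenberg_stevens (W := W) (p := 2)) (hGS' : greenberg_stevens (W := W') (p := 2))
    (hmult : Mult W 2) (hsp : W.HasSplitMultiplicativeReductionAtPrime 2)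
    (hL : W.entireLFunction 1 ≠ 0)
    {κ : ZpExtension ℚ 2} {γ : Field.absoluteGaloisGroup ℚ} {N : ℕ} [NeZero N]
    {f : CuspForm (Gamma0 N) 2} (hκ : κ.IsCyclotomic) (hγ : κ.IsTopGenerator γ)
    (hγ' : IsCyclotomicVariable 2 γ) (hf : IsNewformOf W f) (D : W.SelmerDualData κ γ)
    (D' : W'.SelmerDualData κ γ) (hX : D.IsTorsion) {ϖ ϖ' : ℚ}
    (hϖ : (ϖ : ℝ) * W.realPeriodRat = plusPeriod f) (hϖ' : (ϖ' : ℝ) * W'.realPeriodRat = plusPeriod f) :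
    (D.mu : ℤ) + padicValRat 2 ϖ' = (D'.mu : ℤ) + padicValRat 2 ϖ := by
  haveI : Module.Finite (IwasawaAlgebra 2) D.X := D.module_finite_holds hγ
  haveI : Module.Finite (IwasawaAlgebra 2) D'.X := D'.module_finite_holds hγ
  have hX' : D'.IsTorsion := isTorsion_of_isIsogenous hiso D D' hX
  have hmult' : Mult W' 2 := mult_two_of_isIsogenous hiso hmult
  have hsp' : W'.HasSplitMultiplicativeReductionAtPrime 2 :=
    (hasSplitMultiplicativeReductionAtPrime_two_iff_of_isIsogenous hiso).mp hsp
  have hL' : W'.entireLFunction 1 ≠ 0 := entireLFunction_one_ne_zero_of_isIsogenous hiso hL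
  have hf' : IsNewformOf W' f := hf.of_isIsogenous hiso.symm_of_charZero
  -- ONE split `2`-adic `L`-function of the common newform, read at both members
  obtain ⟨L, hLf⟩ := exists_isSplitMultPAdicLFunctionOf hsp hf
  -- generators
  obtain ⟨fX, hfX⟩ := (charIdeal_isPrincipal_holds 2 D.X).principal
  have hchar : D.charIdeal = Ideal.span {fX} := hfX
  obtain ⟨fX', hfX'⟩ := (charIdeal_isPrincipal_holds 2 D'.X).principal
  have hchar' : D'.charIdeal = Ideal.span {fX'} := hfX'
  -- the dictionaries at both members
  obtain ⟨q, hq, hq0, hfX0, -, hdict⟩ := exists_shaAn_eq_and_valuation_constantCoeff_charGen_eq_split W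
    hEC hGZK hGS hmult hsp hL hκ hγ hγ' hf hLf D hX hϖ hchar
  obtain ⟨q', hq', hq0', -, -, hdict'⟩ := exists_shaAn_eq_and_valuation_constantCoeff_charGen_eq_split W'
    hEC' hGZK hGS' hmult' hsp' hL' hκ hγ hγ' hf' hLf D' hX' hϖ' hchar'
  -- the algebraic shift
  obtain ⟨-, -, hshift⟩ :=
    mu_add_valuation_constantCoeff_eq_of_isIsogenous hiso D D' hX hchar hchar' hfX0
  -- Cassels
  have hr' : W'.analyticRank = 0 := analyticRank_eq_zero_of_entireLFunction_one_ne_zero W' hL'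
  have hfin' : Finite W'.sha := (hGZK W' (by rw [hr']; exact zero_le_one)).2
  have hlead : W'.leadingLCoeff ≠ 0 := W'.leadingLCoeff_ne_zero_holds hf'.hasEntireLFunction
  obtain ⟨hfin, hkey⟩ := finite_sha_and_shaAn_eq_of_isIsogenous hCassels hiso hfin' hlead
  haveI : Finite W.sha := hfin
  haveI : Finite W'.sha := hfin'
  have hshaQ : (W.shaOrder : ℚ) ≠ 0 := by exact_mod_cast (W.shaOrder_pos hfin).ne'
  have hshaQ' : (W'.shaOrder : ℚ) ≠ 0 := by exact_mod_cast (W'.shaOrder_pos hfin').ne'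
  have hqq : q = q' * (W.shaOrder : ℚ) / (W'.shaOrder : ℚ) := by
    have h1 : ((q : ℚ) : ℂ) = ((q' * (W.shaOrder : ℚ) / (W'.shaOrder : ℚ) : ℚ) : ℂ) := by
      rw [← hq, hkey, hq']; push_cast; rfl
    exact_mod_cast h1
  have hvq : padicValRat 2 q = padicValRat 2 q' + (padicValNat 2 W.shaOrder : ℤ) -
      (padicValNat 2 W'.shaOrder : ℤ) := by
    rw [hqq, padicValRat.div (mul_ne_zero hq0' hshaQ) hshaQ', padicValRat.mul hq0' hshaQ,
      padicValRat.of_nat, padicValRat.of_nat]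
  -- assemble
  linarith [hdict, hdict', hshift, hvq]

/-- **THE `μ`-SHIFT LAW AT ANALYTIC RANK `0`, multiplicative `2`, BOTH SIGNS, PRINT-fed.** From the Literature
named facts {guarded Thm-4.1 non-split analogue `h41ns`, A236 `h41sp`, GZK, Cassels} (the displays at both
members are derived inside: `O1.twoAdicEulerCharRankZeroNonsplitMult_zero_of_greenberg'`,
`O1.twoAdicEulerCharRankZeroSplitMult_zero_of_greenberg`) + the MEMO input Greenberg–Stevens at a split `2`
(`hGS`, ∀-closed; used only when `W` is split at `2`). [cite: GreenbergLNM1716, §4 pp. 112–113 and §5 p. 121]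
[cite: MilneADT2006, Thm. I.7.3 (Cassels)] -/
theorem mu_add_padicValRat_eq_of_isIsogenous
    (h41ns : thm41Analogue_charValue_rankZero_numberField_anyPrime_oddLocalDegree)
    (h41sp : thm41Analogue_charValue_rankZero_split_baseChange_anyPrime)
    (hGZK : rank_eq_analyticRank_of_analyticRank_le_one) (hCassels : bsdRHS_eq_of_isIsogenous)
    (hGS : ∀ (V : WeierstrassCurve ℚ) [V.IsElliptic] [V.IsGloballyMinimal],
      V.HasSplitMultiplicativeReductionAtPrime 2 → greenberg_stevens (W := V) (p := 2))
    (hiso : IsIsogenous W W') (hmult : Mult W 2) (hL : W.entireLFunction 1 ≠ 0)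
    {κ : ZpExtension ℚ 2} {γ : Field.absoluteGaloisGroup ℚ} {N : ℕ} [NeZero N]
    {f : CuspForm (Gamma0 N) 2} (hκ : κ.IsCyclotomic) (hγ : κ.IsTopGenerator γ)
    (hγ' : IsCyclotomicVariable 2 γ) (hf : IsNewformOf W f) (D : W.SelmerDualData κ γ)
    (D' : W'.SelmerDualData κ γ) (hX : D.IsTorsion) {ϖ ϖ' : ℚ}
    (hϖ : (ϖ : ℝ) * W.realPeriodRat = plusPeriod f) (hϖ' : (ϖ' : ℝ) * W'.realPeriodRat = plusPeriod f) :
    (D.mu : ℤ) + padicValRat 2 ϖ' = (D'.mu : ℤ) + padicValRat 2 ϖ := by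
  by_cases hsp : W.HasSplitMultiplicativeReductionAtPrime 2
  · have hsp' : W'.HasSplitMultiplicativeReductionAtPrime 2 :=
      (hasSplitMultiplicativeReductionAtPrime_two_iff_of_isIsogenous hiso).mp hsp
    exact mu_add_padicValRat_eq_of_isIsogenous_split hCassels hGZK hiso
      (O1.twoAdicEulerCharRankZeroSplitMult_zero_of_greenberg W h41sp)
      (O1.twoAdicEulerCharRankZeroSplitMult_zero_of_greenberg W' h41sp) (hGS W hsp) (hGS W' hsp')
      hmult hsp hL hκ hγ hγ' hf D D' hX hϖ hϖ'
  · exact mu_add_padicValRat_eq_of_isIsogenous_nonsplit hCassels hGZK hiso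
      (O1.twoAdicEulerCharRankZeroNonsplitMult_zero_of_greenberg' W h41ns)
      (O1.twoAdicEulerCharRankZeroNonsplitMult_zero_of_greenberg' W' h41ns)
      hmult hsp hL hκ hγ hγ' hf D D' hX hϖ hϖ'

end MuShift

end Summit.BirchSwinnertonDyer.BirchSwinnertonDyer.Theorems.MultIsogenyShift

end
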